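import Summits.CriticalPhenomena.Ising3DConformalLimit.Theorems.PlantedPinningMoebiusLimitExistsTransitiveJet
import Summits.CriticalPhenomena.Ising3DConformalLimit.Theorems.PlantedPinningMoebiusLimitExistsJetCompEquiv
import Summits.CriticalPhenomena.Ising3DConformalLimit.Theorems.PlantedPinningMoebiusLimitExistsMultilinearBasis
import Mathlib.Analysis.Calculus.ContDiff.Operations
import HarnessLib

/-!
# PARITY of the Ising₃ Ward-defect jet under the height reflection, and the odd-parity census of the crux
(crux `MoebiusLimitExists`, stmt-CriticalPhenomena-1344, line `Sketch` v22/v23, lead prover-line-stmt-CriticalPhenomena-1344-c20-0;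
THEOREM-ONLY, `--supports stmt-CriticalPhenomena-1344`)

Skeleton v20/v21 (`…TransitiveJet.lean`, p166648) left the crux as `item 1981 ∧ 7⁗_jet≥2`: at each even level `n ≥ 4` the Taylor
coefficients of ORDER `k ≥ 2` of the pointwise `K_{e₀}` defect `D_n(x) = DS_n(x)[(‖xᵢ‖²e₀ − 2⟪e₀,xᵢ⟫xᵢ)ᵢ] − 2Δ(Σ⟪e₀,xᵢ⟫)S_n(x)` of the
limit vanish at the unit regular horizontal `n`-gon `P_n`.  This file halves that list by a PARITY selection rule, valid for EVERY
`O(3)`-invariant level `F` (pure — no limit, analyticity or Ward hypothesis):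

* `defectK1_heightReflection`: the `K_{e₀}` defect is ODD under the height reflection `ẑ : (xᵢ)ᵢ ↦ (Zxᵢ)ᵢ`, `Z` the reflection in
  `e₀^⊥` (Z1 with `R = Z`, `Z e₀ = −e₀`, `E_{−b} = −E_b`);
* `jetK1_heightReflection`: at a configuration `x₀ ⊂ e₀^⊥` the whole Taylor jet is odd, `D^kE(x₀)[ẑm] = −D^kE(x₀)[m]` (P1
  `stub_iteratedFDeriv_comp_continuousLinearEquiv` p166830: jets compose with continuous linear equivalences unconditionally);
* `jetK1_eq_zero_of_reflection_signs`, `jetK1_basis_eq_zero_of_even_vertical`: every Taylor coefficient on `ẑ`-eigendirections with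
  sign product `+1` vanishes — on the standard basis `Pi.single i (EuclideanSpace.single a 1)` of `(ℝ³)ⁿ`: every
  `∂ᵏE/∂x_{i₁a₁}⋯∂x_{i_ka_k}(x₀)` with an EVEN number of vertical slots `aⱼ = 0`;
* `jetK1_eq_zero_of_odd_vertical`: the order-`k` jet vanishes iff its ODD-parity basis coefficients do (P2 `stub_multilinear_eq_zero_of_basis`
  p166842, `Module.Basis.ext_multilinear`);
* census for Ising₃: **item 1982 ⟺ the odd-parity order-`≥ 2` jet upgrade at `P_n`** (`inversionUpgradeNormalised_iff_jetK1GeTwoOddWardUpgrade`)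
  and **crux ⟺ 1981 ∧ 7⁗_jet≥2,odd** (`MoebiusLimitExists_iff_existence_and_jetK1GeTwoOddWardStrict`, route spellings): the registered
  residual `stub_interiorWardK1JetGeTwoOdd` of skeleton v22/v23 is necessary and sufficient given item 1981.

Reading at `(n, k) = (4, 2)`: of the Hessian of `D_4` at the square only the mixed horizontal–vertical block carries conformal content
(c19's count refined: `HH` and `VV` blocks vanish for every `O(3)`-invariant level).  No mechanism for the surviving numbers is claimed.
References: Di Francesco–Mathieu–Sénéchal 1997 §4.1 (4.18)–(4.19), §4.3.1 [FrancescoMathieuSenechal1997]; Duminil-Copin ICM 2022 §8.4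
[DuminilCopinICM2022].  No definitions, no `sorry`.
-/

noncomputable section

namespace Summit.CriticalPhenomena.Ising3DConformalLimit.MoebiusLimitExistsJetParity

open Filter Topology Set Function
open Literature.Probability.LatticeModels Literature.MathematicalPhysics.QuantumFieldTheory
open Summit.CriticalPhenomena.Ising3DConformalLimit.Theses
open Summit.CriticalPhenomena.Ising3DConformalLimit.MoebiusLimitExistsSketchV16 (stub_defect_rotate)
open Summit.CriticalPhenomena.Ising3DConformalLimit.MoebiusLimitExistsSketchV22
  (stub_iteratedFDeriv_comp_continuousLinearEquiv stub_multilinear_eq_zero_of_basis)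
open Summit.CriticalPhenomena.Ising3DConformalLimit.MoebiusLimitExistsDefectSymmetry (defect_neg_left)
open Summit.CriticalPhenomena.Ising3DConformalLimit.MoebiusLimitExistsTransitiveJet
  (inversionUpgradeNormalised_iff_jetK1GeTwoWardUpgrade MoebiusLimitExists_iff_existence_and_jetK1GeTwoWardStrict)

/-! ## A. PARITY of the `K_{e₀}`-defect jet under the height reflection (pure: any `O(3)`-invariant level) -/

/-- **The `K_{e₀}` defect of an `O(3)`-invariant level is ODD under the height reflection** `ẑ : (xᵢ)ᵢ ↦ (Z xᵢ)ᵢ`, `Z` the reflection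
in the plane `e₀^⊥` (Z1 with `R = Z`, `Z e₀ = −e₀`, and `E_{−b} = −E_b`): `E_{e₀}(F)(ẑ x) = −E_{e₀}(F)(x)` for every configuration `x`.
[cite: FrancescoMathieuSenechal1997, §4.1 (4.18)–(4.19)] -/
theorem defectK1_heightReflection (n : ℕ) (F : (Fin n → EuclideanSpace ℝ (Fin 3)) → ℝ) (Δ : ℝ)
    (hrot : ∀ (R : EuclideanSpace ℝ (Fin 3) ≃ₗᵢ[ℝ] EuclideanSpace ℝ (Fin 3)) (y : Fin n → EuclideanSpace ℝ (Fin 3)),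
      F (fun i => R (y i)) = F y)
    (x : Fin n → EuclideanSpace ℝ (Fin 3)) :
    fderiv ℝ F (fun i => (ℝ ∙ (EuclideanSpace.single 0 1 : EuclideanSpace ℝ (Fin 3)))ᗮ.reflection (x i))
        (fun i => ‖(ℝ ∙ (EuclideanSpace.single 0 1 : EuclideanSpace ℝ (Fin 3)))ᗮ.reflection (x i)‖ ^ 2 •
            (EuclideanSpace.single 0 1 : EuclideanSpace ℝ (Fin 3)) -
          (2 * inner ℝ (EuclideanSpace.single 0 1 : EuclideanSpace ℝ (Fin 3))
            ((ℝ ∙ (EuclideanSpace.single 0 1 : EuclideanSpace ℝ (Fin 3)))ᗮ.reflection (x i))) •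
            (ℝ ∙ (EuclideanSpace.single 0 1 : EuclideanSpace ℝ (Fin 3)))ᗮ.reflection (x i)) -
        2 * Δ * (∑ i, inner ℝ (EuclideanSpace.single 0 1 : EuclideanSpace ℝ (Fin 3))
          ((ℝ ∙ (EuclideanSpace.single 0 1 : EuclideanSpace ℝ (Fin 3)))ᗮ.reflection (x i))) *
          F (fun i => (ℝ ∙ (EuclideanSpace.single 0 1 : EuclideanSpace ℝ (Fin 3)))ᗮ.reflection (x i)) =
      -(fderiv ℝ F x (fun i => ‖x i‖ ^ 2 • (EuclideanSpace.single 0 1 : EuclideanSpace ℝ (Fin 3)) -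
          (2 * inner ℝ (EuclideanSpace.single 0 1 : EuclideanSpace ℝ (Fin 3)) (x i)) • x i) -
        2 * Δ * (∑ i, inner ℝ (EuclideanSpace.single 0 1 : EuclideanSpace ℝ (Fin 3)) (x i)) * F x) := by
  set e0 : EuclideanSpace ℝ (Fin 3) := EuclideanSpace.single 0 1 with he0
  set Z : EuclideanSpace ℝ (Fin 3) ≃ₗᵢ[ℝ] EuclideanSpace ℝ (Fin 3) := (ℝ ∙ e0)ᗮ.reflection with hZ
  set 𝓔 : EuclideanSpace ℝ (Fin 3) → (Fin n → EuclideanSpace ℝ (Fin 3)) → ℝ := fun b' y =>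
    fderiv ℝ F y (fun i => ‖y i‖ ^ 2 • b' - (2 * inner ℝ b' (y i)) • y i) - 2 * Δ * (∑ i, inner ℝ b' (y i)) * F y with h𝓔
  have hZe0 : Z e0 = -e0 := by
    rw [hZ, Submodule.reflection_orthogonal_apply, Submodule.reflection_mem_subspace_eq_self (Submodule.mem_span_singleton_self e0)]
  -- Z1 with `R = Z`
  have h1 : 𝓔 (Z e0) (fun i => Z (x i)) = 𝓔 e0 x := by
    have h := stub_defect_rotate n F Δ Z (fun y => hrot Z y) e0 x
    simpa only [h𝓔, LinearIsometryEquiv.norm_map, LinearIsometryEquiv.inner_map_map] using h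
  have h2 : 𝓔 (-e0) (fun i => Z (x i)) = -𝓔 e0 (fun i => Z (x i)) := by
    simp only [h𝓔]
    exact defect_neg_left n F Δ e0 _
  rw [hZe0] at h1
  have h3 : 𝓔 e0 (fun i => Z (x i)) = -𝓔 e0 x := by linarith
  simpa only [h𝓔] using h3

/-- **PARITY of the jet: at a configuration in the plane `e₀^⊥`, the Taylor jet of the `K_{e₀}` defect of an `O(3)`-invariant level is
ODD under the height reflection**: `D^kE(x₀)[ẑm₁,…,ẑm_k] = −D^kE(x₀)[m₁,…,m_k]` for every order `k` and all directions (oddness of the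
defect, P1, `ẑ x₀ = x₀`).  No differentiability hypothesis. [cite: FrancescoMathieuSenechal1997, §4.1 (4.18)–(4.19)] -/
theorem jetK1_heightReflection (n : ℕ) (F : (Fin n → EuclideanSpace ℝ (Fin 3)) → ℝ) (Δ : ℝ)
    (hrot : ∀ (R : EuclideanSpace ℝ (Fin 3) ≃ₗᵢ[ℝ] EuclideanSpace ℝ (Fin 3)) (y : Fin n → EuclideanSpace ℝ (Fin 3)),
      F (fun i => R (y i)) = F y)
    (x₀ : Fin n → EuclideanSpace ℝ (Fin 3))
    (hplane : ∀ i, inner ℝ (EuclideanSpace.single 0 1 : EuclideanSpace ℝ (Fin 3)) (x₀ i) = 0)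
    (k : ℕ) (m : Fin k → Fin n → EuclideanSpace ℝ (Fin 3)) :
    iteratedFDeriv ℝ k (fun x : Fin n → EuclideanSpace ℝ (Fin 3) =>
        fderiv ℝ F x (fun i => ‖x i‖ ^ 2 • (EuclideanSpace.single 0 1 : EuclideanSpace ℝ (Fin 3)) -
          (2 * inner ℝ (EuclideanSpace.single 0 1 : EuclideanSpace ℝ (Fin 3)) (x i)) • x i) -
        2 * Δ * (∑ i, inner ℝ (EuclideanSpace.single 0 1 : EuclideanSpace ℝ (Fin 3)) (x i)) * F x) x₀
        (fun j i => (ℝ ∙ (EuclideanSpace.single 0 1 : EuclideanSpace ℝ (Fin 3)))ᗮ.reflection (m j i)) =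
      -iteratedFDeriv ℝ k (fun x : Fin n → EuclideanSpace ℝ (Fin 3) =>
        fderiv ℝ F x (fun i => ‖x i‖ ^ 2 • (EuclideanSpace.single 0 1 : EuclideanSpace ℝ (Fin 3)) -
          (2 * inner ℝ (EuclideanSpace.single 0 1 : EuclideanSpace ℝ (Fin 3)) (x i)) • x i) -
        2 * Δ * (∑ i, inner ℝ (EuclideanSpace.single 0 1 : EuclideanSpace ℝ (Fin 3)) (x i)) * F x) x₀ m := by
  set e0 : EuclideanSpace ℝ (Fin 3) := EuclideanSpace.single 0 1 with he0
  set D : (Fin n → EuclideanSpace ℝ (Fin 3)) → ℝ := fun x =>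
    fderiv ℝ F x (fun i => ‖x i‖ ^ 2 • e0 - (2 * inner ℝ e0 (x i)) • x i) - 2 * Δ * (∑ i, inner ℝ e0 (x i)) * F x with hD
  set Z : EuclideanSpace ℝ (Fin 3) ≃ₗᵢ[ℝ] EuclideanSpace ℝ (Fin 3) := (ℝ ∙ e0)ᗮ.reflection with hZ
  -- the diagonal height reflection as a continuous linear equivalence of the configuration space
  set g : (Fin n → EuclideanSpace ℝ (Fin 3)) ≃L[ℝ] (Fin n → EuclideanSpace ℝ (Fin 3)) :=
    ContinuousLinearEquiv.piCongrRight fun _ => Z.toContinuousLinearEquiv with hg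
  have hgapply : ∀ y : Fin n → EuclideanSpace ℝ (Fin 3), g y = fun i => Z (y i) := fun y => rfl
  have hgx₀ : g x₀ = x₀ := by
    rw [hgapply]
    funext i
    exact Submodule.reflection_mem_subspace_eq_self ((Submodule.mem_orthogonal_singleton_iff_inner_right).2 (hplane i))
  have hodd : D ∘ g = -D := funext fun y => by
    have h := defectK1_heightReflection n F Δ hrot y
    simpa only [hD, comp_apply, hgapply, Pi.neg_apply] using h
  have h := stub_iteratedFDeriv_comp_continuousLinearEquiv n k D g x₀ m
  rw [hodd, iteratedFDeriv_neg_apply, hgx₀, neg_apply] at h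
  have hgm : (fun j => g (m j)) = fun j i => Z (m j i) := funext fun j => hgapply (m j)
  rw [hgm] at h
  linarith

/-- **Sign selection rule.**  If each direction `mⱼ` is an eigenvector of the height reflection, `ẑ mⱼ = εⱼ mⱼ`, and `∏ εⱼ = 1` (an
EVEN number of `εⱼ = −1`), then `D^kE(x₀)[m₁,…,m_k] = 0` (parity + multilinearity). [cite: FrancescoMathieuSenechal1997, §4.1 (4.18)–(4.19)] -/
theorem jetK1_eq_zero_of_reflection_signs (n : ℕ) (F : (Fin n → EuclideanSpace ℝ (Fin 3)) → ℝ) (Δ : ℝ)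
    (hrot : ∀ (R : EuclideanSpace ℝ (Fin 3) ≃ₗᵢ[ℝ] EuclideanSpace ℝ (Fin 3)) (y : Fin n → EuclideanSpace ℝ (Fin 3)),
      F (fun i => R (y i)) = F y)
    (x₀ : Fin n → EuclideanSpace ℝ (Fin 3))
    (hplane : ∀ i, inner ℝ (EuclideanSpace.single 0 1 : EuclideanSpace ℝ (Fin 3)) (x₀ i) = 0)
    (k : ℕ) (m : Fin k → Fin n → EuclideanSpace ℝ (Fin 3)) (ε : Fin k → ℝ)
    (hm : ∀ j, (fun i => (ℝ ∙ (EuclideanSpace.single 0 1 : EuclideanSpace ℝ (Fin 3)))ᗮ.reflection (m j i)) = ε j • m j)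
    (hε : ∏ j, ε j = 1) :
    iteratedFDeriv ℝ k (fun x : Fin n → EuclideanSpace ℝ (Fin 3) =>
        fderiv ℝ F x (fun i => ‖x i‖ ^ 2 • (EuclideanSpace.single 0 1 : EuclideanSpace ℝ (Fin 3)) -
          (2 * inner ℝ (EuclideanSpace.single 0 1 : EuclideanSpace ℝ (Fin 3)) (x i)) • x i) -
        2 * Δ * (∑ i, inner ℝ (EuclideanSpace.single 0 1 : EuclideanSpace ℝ (Fin 3)) (x i)) * F x) x₀ m = 0 := by
  have h := jetK1_heightReflection n F Δ hrot x₀ hplane k m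
  have hm' : (fun j i => (ℝ ∙ (EuclideanSpace.single 0 1 : EuclideanSpace ℝ (Fin 3)))ᗮ.reflection (m j i)) =
      fun j => ε j • m j := funext fun j => hm j
  rw [hm', ContinuousMultilinearMap.map_smul_univ, hε, one_smul] at h
  linarith

/-- **Standard-basis form of the parity rule.**  The standard basis vector `Pi.single i (EuclideanSpace.single a 1)` of `(ℝ³)ⁿ` is
reversed by the height reflection if `a = 0` (vertical) and fixed otherwise (horizontal); hence at a configuration in `e₀^⊥` every Taylor
coefficient `∂ᵏE/∂x_{i₁a₁}⋯∂x_{i_ka_k}(x₀)` with an EVEN number of vertical slots `aⱼ = 0` vanishes, for every `O(3)`-invariant level.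
[cite: FrancescoMathieuSenechal1997, §4.1 (4.18)–(4.19)] -/
theorem jetK1_basis_eq_zero_of_even_vertical (n : ℕ) (F : (Fin n → EuclideanSpace ℝ (Fin 3)) → ℝ) (Δ : ℝ)
    (hrot : ∀ (R : EuclideanSpace ℝ (Fin 3) ≃ₗᵢ[ℝ] EuclideanSpace ℝ (Fin 3)) (y : Fin n → EuclideanSpace ℝ (Fin 3)),
      F (fun i => R (y i)) = F y)
    (x₀ : Fin n → EuclideanSpace ℝ (Fin 3))
    (hplane : ∀ i, inner ℝ (EuclideanSpace.single 0 1 : EuclideanSpace ℝ (Fin 3)) (x₀ i) = 0)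
    (k : ℕ) (idx : Fin k → Fin n × Fin 3)
    (heven : Even (Finset.univ.filter fun j => (idx j).2 = 0).card) :
    iteratedFDeriv ℝ k (fun x : Fin n → EuclideanSpace ℝ (Fin 3) =>
        fderiv ℝ F x (fun i => ‖x i‖ ^ 2 • (EuclideanSpace.single 0 1 : EuclideanSpace ℝ (Fin 3)) -
          (2 * inner ℝ (EuclideanSpace.single 0 1 : EuclideanSpace ℝ (Fin 3)) (x i)) • x i) -
        2 * Δ * (∑ i, inner ℝ (EuclideanSpace.single 0 1 : EuclideanSpace ℝ (Fin 3)) (x i)) * F x) x₀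
        (fun j => Pi.single (idx j).1 (EuclideanSpace.single (idx j).2 (1:ℝ))) = 0 := by
  set e0 : EuclideanSpace ℝ (Fin 3) := EuclideanSpace.single 0 1 with he0
  set Z : EuclideanSpace ℝ (Fin 3) ≃ₗᵢ[ℝ] EuclideanSpace ℝ (Fin 3) := (ℝ ∙ e0)ᗮ.reflection with hZ
  -- the action of `Z` on the basis vectors of `ℝ³`
  have hZsingle : ∀ a : Fin 3, Z (EuclideanSpace.single a 1) =
      (if a = 0 then (-1:ℝ) else 1) • EuclideanSpace.single a 1 := fun a => by
    by_cases ha : a = 0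
    · subst ha
      rw [if_pos rfl, neg_one_smul, hZ, Submodule.reflection_orthogonal_apply,
        Submodule.reflection_mem_subspace_eq_self (Submodule.mem_span_singleton_self e0)]
    · rw [if_neg ha, one_smul, hZ]
      apply Submodule.reflection_mem_subspace_eq_self
      rw [Submodule.mem_orthogonal_singleton_iff_inner_right, he0, EuclideanSpace.inner_single_left]
      simp [ha]
  refine jetK1_eq_zero_of_reflection_signs n F Δ hrot x₀ hplane k _ (fun j => if (idx j).2 = 0 then (-1:ℝ) else 1)
    (fun j => ?_) ?_
  · funext i
    by_cases hi : i = (idx j).1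
    · subst hi
      simp only [Pi.smul_apply, Pi.single_eq_same]
      exact hZsingle _
    · simp only [Pi.smul_apply, Pi.single_eq_of_ne hi, map_zero, smul_zero]
  · rw [Finset.prod_ite, Finset.prod_const, Finset.prod_const_one, mul_one]
    exact heven.neg_one_pow

/-- **The order-`k` jet vanishes as soon as its standard-basis coefficients with an ODD number of vertical slots vanish** (at a
configuration in `e₀^⊥`, for an `O(3)`-invariant level): the even ones vanish by parity, and a multilinear form is determined by its
values on basis tuples (P2). [cite: FrancescoMathieuSenechal1997, §4.1 (4.18)–(4.19)] -/
theorem jetK1_eq_zero_of_odd_vertical (n : ℕ) (F : (Fin n → EuclideanSpace ℝ (Fin 3)) → ℝ) (Δ : ℝ)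
    (hrot : ∀ (R : EuclideanSpace ℝ (Fin 3) ≃ₗᵢ[ℝ] EuclideanSpace ℝ (Fin 3)) (y : Fin n → EuclideanSpace ℝ (Fin 3)),
      F (fun i => R (y i)) = F y)
    (x₀ : Fin n → EuclideanSpace ℝ (Fin 3))
    (hplane : ∀ i, inner ℝ (EuclideanSpace.single 0 1 : EuclideanSpace ℝ (Fin 3)) (x₀ i) = 0) (k : ℕ)
    (hodd : ∀ idx : Fin k → Fin n × Fin 3, Odd (Finset.univ.filter fun j => (idx j).2 = 0).card →
      iteratedFDeriv ℝ k (fun x : Fin n → EuclideanSpace ℝ (Fin 3) =>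
        fderiv ℝ F x (fun i => ‖x i‖ ^ 2 • (EuclideanSpace.single 0 1 : EuclideanSpace ℝ (Fin 3)) -
          (2 * inner ℝ (EuclideanSpace.single 0 1 : EuclideanSpace ℝ (Fin 3)) (x i)) • x i) -
        2 * Δ * (∑ i, inner ℝ (EuclideanSpace.single 0 1 : EuclideanSpace ℝ (Fin 3)) (x i)) * F x) x₀
        (fun j => Pi.single (idx j).1 (EuclideanSpace.single (idx j).2 (1:ℝ))) = 0) :
    iteratedFDeriv ℝ k (fun x : Fin n → EuclideanSpace ℝ (Fin 3) =>
        fderiv ℝ F x (fun i => ‖x i‖ ^ 2 • (EuclideanSpace.single 0 1 : EuclideanSpace ℝ (Fin 3)) -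
          (2 * inner ℝ (EuclideanSpace.single 0 1 : EuclideanSpace ℝ (Fin 3)) (x i)) • x i) -
        2 * Δ * (∑ i, inner ℝ (EuclideanSpace.single 0 1 : EuclideanSpace ℝ (Fin 3)) (x i)) * F x) x₀ = 0 := by
  refine stub_multilinear_eq_zero_of_basis n k _ fun idx => ?_
  rcases Nat.even_or_odd (Finset.univ.filter fun j => (idx j).2 = 0).card with he | ho
  · exact jetK1_basis_eq_zero_of_even_vertical n F Δ hrot x₀ hplane k idx he
  · exact hodd idx ho


/-! ## B. Census for Ising₃ limits: 1982 ⟺ the odd-parity order-`≥ 2` jet upgrade; crux ⟺ 1981 ∧ 7⁗_jet≥2,odd -/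

section Limit

variable {Δ : ℝ} {S : CorrFamily 3}

/-- **For an `O(3)`-invariant family, the order-`≥ 2` jet of `D_n` at `P_n` vanishes iff its odd-parity basis coefficients do** (`P_n ⊂ e₀^⊥`).
[cite: FrancescoMathieuSenechal1997, §4.1 (4.18)–(4.19)] -/
theorem jetK1GeTwo_iff_jetK1GeTwoOdd (hrot : IsRotationInvariant S) (n k : ℕ) :
    iteratedFDeriv ℝ k (fun x : Fin n → EuclideanSpace ℝ (Fin 3) =>
            fderiv ℝ (S n) x (fun i => ‖x i‖ ^ 2 • (EuclideanSpace.single 0 1 : EuclideanSpace ℝ (Fin 3)) -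
              (2 * inner ℝ (EuclideanSpace.single 0 1 : EuclideanSpace ℝ (Fin 3)) (x i)) • x i) -
            2 * Δ * (∑ i, inner ℝ (EuclideanSpace.single 0 1 : EuclideanSpace ℝ (Fin 3)) (x i)) * S n x)
            (fun i : Fin n => Real.cos (2 * Real.pi * ((i : ℕ) : ℝ) / (n : ℝ)) • (EuclideanSpace.single 1 1 : EuclideanSpace ℝ (Fin 3)) +
              Real.sin (2 * Real.pi * ((i : ℕ) : ℝ) / (n : ℝ)) • (EuclideanSpace.single 2 1 : EuclideanSpace ℝ (Fin 3))) = 0 ↔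
      ∀ idx : Fin k → Fin n × Fin 3, Odd (Finset.univ.filter fun j => (idx j).2 = 0).card →
        iteratedFDeriv ℝ k (fun x : Fin n → EuclideanSpace ℝ (Fin 3) =>
            fderiv ℝ (S n) x (fun i => ‖x i‖ ^ 2 • (EuclideanSpace.single 0 1 : EuclideanSpace ℝ (Fin 3)) -
              (2 * inner ℝ (EuclideanSpace.single 0 1 : EuclideanSpace ℝ (Fin 3)) (x i)) • x i) -
            2 * Δ * (∑ i, inner ℝ (EuclideanSpace.single 0 1 : EuclideanSpace ℝ (Fin 3)) (x i)) * S n x)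
            (fun i : Fin n => Real.cos (2 * Real.pi * ((i : ℕ) : ℝ) / (n : ℝ)) • (EuclideanSpace.single 1 1 : EuclideanSpace ℝ (Fin 3)) +
              Real.sin (2 * Real.pi * ((i : ℕ) : ℝ) / (n : ℝ)) • (EuclideanSpace.single 2 1 : EuclideanSpace ℝ (Fin 3))) (fun j => Pi.single (idx j).1 (EuclideanSpace.single (idx j).2 (1:ℝ))) = 0 :=
  ⟨fun h idx _ => by rw [h]; rfl,
    fun h => jetK1_eq_zero_of_odd_vertical n (S n) Δ (fun R y => hrot n R y) _
      (fun i => by rw [EuclideanSpace.inner_single_left]; simp) k h⟩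

end Limit

/-- **Item 1982 ⟺ the odd-parity order-`≥ 2` jet upgrade at the regular polygon.** [cite: FrancescoMathieuSenechal1997, §4.3.1 eq. (4.62)] -/
theorem inversionUpgradeNormalised_iff_jetK1GeTwoOddWardUpgrade :
    HyperoctahedralRP.InversionUpgradeNormalised ↔
      (∀ (ρ : ℝ → ℝ) (Δ : ℝ) (S : CorrFamily 3), (∀ δ ∈ Set.Ioc (0:ℝ) 1, 0 < ρ δ) →
        HasPointwiseScalingLimit (criticalCorr 3) ρ S → (∀ n z, z ∉ NonCoincident 3 n → S n z = 0) →
        IsNondegenerateTwoPoint S → IsEuclideanInvariant S → IsScaleCovariant Δ S →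
        ∀ n, 4 ≤ n → Even n → ∀ k : ℕ, 2 ≤ k → ∀ idx : Fin k → Fin n × Fin 3,
          Odd (Finset.univ.filter fun j => (idx j).2 = 0).card →
          iteratedFDeriv ℝ k (fun x : Fin n → EuclideanSpace ℝ (Fin 3) =>
            fderiv ℝ (S n) x (fun i => ‖x i‖ ^ 2 • (EuclideanSpace.single 0 1 : EuclideanSpace ℝ (Fin 3)) -
              (2 * inner ℝ (EuclideanSpace.single 0 1 : EuclideanSpace ℝ (Fin 3)) (x i)) • x i) -
            2 * Δ * (∑ i, inner ℝ (EuclideanSpace.single 0 1 : EuclideanSpace ℝ (Fin 3)) (x i)) * S n x)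
            (fun i : Fin n => Real.cos (2 * Real.pi * ((i : ℕ) : ℝ) / (n : ℝ)) • (EuclideanSpace.single 1 1 : EuclideanSpace ℝ (Fin 3)) +
              Real.sin (2 * Real.pi * ((i : ℕ) : ℝ) / (n : ℝ)) • (EuclideanSpace.single 2 1 : EuclideanSpace ℝ (Fin 3))) (fun j => Pi.single (idx j).1 (EuclideanSpace.single (idx j).2 (1:ℝ))) = 0) := by
  rw [inversionUpgradeNormalised_iff_jetK1GeTwoWardUpgrade]
  refine forall_congr' fun ρ => forall_congr' fun Δ => forall_congr' fun S => forall_congr' fun _ =>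
    forall_congr' fun _ => forall_congr' fun _ => forall_congr' fun _ => forall_congr' fun heuc =>
    forall_congr' fun _ => forall_congr' fun n => forall_congr' fun _ => forall_congr' fun _ =>
    forall_congr' fun k => forall_congr' fun _ => ?_
  exact jetK1GeTwo_iff_jetK1GeTwoOdd heuc.2 n k

/-- **The crux implies 7⁗_jet≥2,odd**: the residual of skeleton v22/v23 is necessary. [cite: DuminilCopinICM2022, §8.4] -/
theorem jetK1GeTwoOddWardStrict_of_MoebiusLimitExists (hcrux : PerfectScreening.MoebiusLimitExists) : (∀ (ρ : ℝ → ℝ) (Δ : ℝ) (S : CorrFamily 3), (∀ δ ∈ Set.Ioc (0:ℝ) 1, 0 < ρ δ) →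
        HasPointwiseScalingLimit (criticalCorr 3) ρ S → (∀ n z, z ∉ NonCoincident 3 n → S n z = 0) →
        IsNondegenerateTwoPoint S → IsEuclideanInvariant S → IsScaleCovariant Δ S →
        1 / 2 < Δ → Δ ≤ 3 / 4 → HasNontrivialU4 S →
        (∀ τ : Fin 3, PointwiseOSReconstruction τ S) →
        (∀ (n m : ℕ) (x : Fin n → EuclideanSpace ℝ (Fin 3)) (y : Fin m → EuclideanSpace ℝ (Fin 3))
          (v : EuclideanSpace ℝ (Fin 3)), v ≠ 0 →
          Tendsto (fun t : ℝ => S (n + m) (Fin.append x (fun j => y j + t • v)) - S n x * S m y)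
            atTop (𝓝 0)) →
        ∀ n, 4 ≤ n → Even n → ∀ k : ℕ, 2 ≤ k → ∀ idx : Fin k → Fin n × Fin 3,
          Odd (Finset.univ.filter fun j => (idx j).2 = 0).card →
          iteratedFDeriv ℝ k (fun x : Fin n → EuclideanSpace ℝ (Fin 3) =>
            fderiv ℝ (S n) x (fun i => ‖x i‖ ^ 2 • (EuclideanSpace.single 0 1 : EuclideanSpace ℝ (Fin 3)) -
              (2 * inner ℝ (EuclideanSpace.single 0 1 : EuclideanSpace ℝ (Fin 3)) (x i)) • x i) -
            2 * Δ * (∑ i, inner ℝ (EuclideanSpace.single 0 1 : EuclideanSpace ℝ (Fin 3)) (x i)) * S n x)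
            (fun i : Fin n => Real.cos (2 * Real.pi * ((i : ℕ) : ℝ) / (n : ℝ)) • (EuclideanSpace.single 1 1 : EuclideanSpace ℝ (Fin 3)) +
              Real.sin (2 * Real.pi * ((i : ℕ) : ℝ) / (n : ℝ)) • (EuclideanSpace.single 2 1 : EuclideanSpace ℝ (Fin 3)))
            (fun j => Pi.single (idx j).1 (EuclideanSpace.single (idx j).2 (1:ℝ))) = 0) :=
  fun ρ Δ S hρ hlim hnorm hnd heuc hsc hlt hle hU4 hos hcl n hn4 he k hk =>
    (jetK1GeTwo_iff_jetK1GeTwoOdd heuc.2 n k).1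
      ((MoebiusLimitExists_iff_existence_and_jetK1GeTwoWardStrict.1 hcrux).2 ρ Δ S hρ hlim hnorm hnd heuc hsc hlt hle hU4 hos hcl
        n hn4 he k hk)

/-- **TIGHTNESS of skeleton v22/v23: `MoebiusLimitExists ⟺ ExistsScaleCovariantLimit (1981) ∧ 7⁗_jet≥2,odd`.** [cite: DuminilCopinICM2022, §8.4] -/
theorem MoebiusLimitExists_iff_existence_and_jetK1GeTwoOddWardStrict :
    PerfectScreening.MoebiusLimitExists ↔ HyperoctahedralRP.ExistsScaleCovariantLimit ∧ (∀ (ρ : ℝ → ℝ) (Δ : ℝ) (S : CorrFamily 3), (∀ δ ∈ Set.Ioc (0:ℝ) 1, 0 < ρ δ) →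
        HasPointwiseScalingLimit (criticalCorr 3) ρ S → (∀ n z, z ∉ NonCoincident 3 n → S n z = 0) →
        IsNondegenerateTwoPoint S → IsEuclideanInvariant S → IsScaleCovariant Δ S →
        1 / 2 < Δ → Δ ≤ 3 / 4 → HasNontrivialU4 S →
        (∀ τ : Fin 3, PointwiseOSReconstruction τ S) →
        (∀ (n m : ℕ) (x : Fin n → EuclideanSpace ℝ (Fin 3)) (y : Fin m → EuclideanSpace ℝ (Fin 3))
          (v : EuclideanSpace ℝ (Fin 3)), v ≠ 0 →
          Tendsto (fun t : ℝ => S (n + m) (Fin.append x (fun j => y j + t • v)) - S n x * S m y)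
            atTop (𝓝 0)) →
        ∀ n, 4 ≤ n → Even n → ∀ k : ℕ, 2 ≤ k → ∀ idx : Fin k → Fin n × Fin 3,
          Odd (Finset.univ.filter fun j => (idx j).2 = 0).card →
          iteratedFDeriv ℝ k (fun x : Fin n → EuclideanSpace ℝ (Fin 3) =>
            fderiv ℝ (S n) x (fun i => ‖x i‖ ^ 2 • (EuclideanSpace.single 0 1 : EuclideanSpace ℝ (Fin 3)) -
              (2 * inner ℝ (EuclideanSpace.single 0 1 : EuclideanSpace ℝ (Fin 3)) (x i)) • x i) -
            2 * Δ * (∑ i, inner ℝ (EuclideanSpace.single 0 1 : EuclideanSpace ℝ (Fin 3)) (x i)) * S n x)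
            (fun i : Fin n => Real.cos (2 * Real.pi * ((i : ℕ) : ℝ) / (n : ℝ)) • (EuclideanSpace.single 1 1 : EuclideanSpace ℝ (Fin 3)) +
              Real.sin (2 * Real.pi * ((i : ℕ) : ℝ) / (n : ℝ)) • (EuclideanSpace.single 2 1 : EuclideanSpace ℝ (Fin 3)))
            (fun j => Pi.single (idx j).1 (EuclideanSpace.single (idx j).2 (1:ℝ))) = 0) := by
  rw [MoebiusLimitExists_iff_existence_and_jetK1GeTwoWardStrict]
  refine and_congr_right fun _ => ?_
  refine forall_congr' fun ρ => forall_congr' fun Δ => forall_congr' fun S => forall_congr' fun _ =>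
    forall_congr' fun _ => forall_congr' fun _ => forall_congr' fun _ => forall_congr' fun heuc =>
    forall_congr' fun _ => forall_congr' fun _ => forall_congr' fun _ => forall_congr' fun _ =>
    forall_congr' fun _ => forall_congr' fun _ => forall_congr' fun n => forall_congr' fun _ =>
    forall_congr' fun _ => forall_congr' fun k => forall_congr' fun _ => ?_
  exact jetK1GeTwo_iff_jetK1GeTwoOdd heuc.2 n k

/-- **The crux ⇐ item 1981 ∧ 7⁗_jet≥2,odd** (the composition of skeleton v22/v23). [cite: DuminilCopinICM2022, §8.4] -/
theorem MoebiusLimitExists_of_existence_of_jetK1GeTwoOddWardStrict (hE : HyperoctahedralRP.ExistsScaleCovariantLimit)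
    (h7 : (∀ (ρ : ℝ → ℝ) (Δ : ℝ) (S : CorrFamily 3), (∀ δ ∈ Set.Ioc (0:ℝ) 1, 0 < ρ δ) →
        HasPointwiseScalingLimit (criticalCorr 3) ρ S → (∀ n z, z ∉ NonCoincident 3 n → S n z = 0) →
        IsNondegenerateTwoPoint S → IsEuclideanInvariant S → IsScaleCovariant Δ S →
        1 / 2 < Δ → Δ ≤ 3 / 4 → HasNontrivialU4 S →
        (∀ τ : Fin 3, PointwiseOSReconstruction τ S) →
        (∀ (n m : ℕ) (x : Fin n → EuclideanSpace ℝ (Fin 3)) (y : Fin m → EuclideanSpace ℝ (Fin 3))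
          (v : EuclideanSpace ℝ (Fin 3)), v ≠ 0 →
          Tendsto (fun t : ℝ => S (n + m) (Fin.append x (fun j => y j + t • v)) - S n x * S m y)
            atTop (𝓝 0)) →
        ∀ n, 4 ≤ n → Even n → ∀ k : ℕ, 2 ≤ k → ∀ idx : Fin k → Fin n × Fin 3,
          Odd (Finset.univ.filter fun j => (idx j).2 = 0).card →
          iteratedFDeriv ℝ k (fun x : Fin n → EuclideanSpace ℝ (Fin 3) =>
            fderiv ℝ (S n) x (fun i => ‖x i‖ ^ 2 • (EuclideanSpace.single 0 1 : EuclideanSpace ℝ (Fin 3)) -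
              (2 * inner ℝ (EuclideanSpace.single 0 1 : EuclideanSpace ℝ (Fin 3)) (x i)) • x i) -
            2 * Δ * (∑ i, inner ℝ (EuclideanSpace.single 0 1 : EuclideanSpace ℝ (Fin 3)) (x i)) * S n x)
            (fun i : Fin n => Real.cos (2 * Real.pi * ((i : ℕ) : ℝ) / (n : ℝ)) • (EuclideanSpace.single 1 1 : EuclideanSpace ℝ (Fin 3)) +
              Real.sin (2 * Real.pi * ((i : ℕ) : ℝ) / (n : ℝ)) • (EuclideanSpace.single 2 1 : EuclideanSpace ℝ (Fin 3)))
            (fun j => Pi.single (idx j).1 (EuclideanSpace.single (idx j).2 (1:ℝ))) = 0)) :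
    PerfectScreening.MoebiusLimitExists :=
  MoebiusLimitExists_iff_existence_and_jetK1GeTwoOddWardStrict.2 ⟨hE, h7⟩

/-- Route PlantedPinning's spelling of the sufficiency direction. [cite: DuminilCopinICM2022, §8.4] -/
theorem plantedPinning_MoebiusLimitExists_of_existence_of_jetK1GeTwoOddWardStrict
    (hE : HyperoctahedralRP.ExistsScaleCovariantLimit) (h7 : (∀ (ρ : ℝ → ℝ) (Δ : ℝ) (S : CorrFamily 3), (∀ δ ∈ Set.Ioc (0:ℝ) 1, 0 < ρ δ) →
        HasPointwiseScalingLimit (criticalCorr 3) ρ S → (∀ n z, z ∉ NonCoincident 3 n → S n z = 0) →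
        IsNondegenerateTwoPoint S → IsEuclideanInvariant S → IsScaleCovariant Δ S →
        1 / 2 < Δ → Δ ≤ 3 / 4 → HasNontrivialU4 S →
        (∀ τ : Fin 3, PointwiseOSReconstruction τ S) →
        (∀ (n m : ℕ) (x : Fin n → EuclideanSpace ℝ (Fin 3)) (y : Fin m → EuclideanSpace ℝ (Fin 3))
          (v : EuclideanSpace ℝ (Fin 3)), v ≠ 0 →
          Tendsto (fun t : ℝ => S (n + m) (Fin.append x (fun j => y j + t • v)) - S n x * S m y)
            atTop (𝓝 0)) →
        ∀ n, 4 ≤ n → Even n → ∀ k : ℕ, 2 ≤ k → ∀ idx : Fin k → Fin n × Fin 3,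
          Odd (Finset.univ.filter fun j => (idx j).2 = 0).card →
          iteratedFDeriv ℝ k (fun x : Fin n → EuclideanSpace ℝ (Fin 3) =>
            fderiv ℝ (S n) x (fun i => ‖x i‖ ^ 2 • (EuclideanSpace.single 0 1 : EuclideanSpace ℝ (Fin 3)) -
              (2 * inner ℝ (EuclideanSpace.single 0 1 : EuclideanSpace ℝ (Fin 3)) (x i)) • x i) -
            2 * Δ * (∑ i, inner ℝ (EuclideanSpace.single 0 1 : EuclideanSpace ℝ (Fin 3)) (x i)) * S n x)
            (fun i : Fin n => Real.cos (2 * Real.pi * ((i : ℕ) : ℝ) / (n : ℝ)) • (EuclideanSpace.single 1 1 : EuclideanSpace ℝ (Fin 3)) +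
              Real.sin (2 * Real.pi * ((i : ℕ) : ℝ) / (n : ℝ)) • (EuclideanSpace.single 2 1 : EuclideanSpace ℝ (Fin 3)))
            (fun j => Pi.single (idx j).1 (EuclideanSpace.single (idx j).2 (1:ℝ))) = 0)) :
    PlantedPinning.MoebiusLimitExists :=
  MoebiusLimitExists_of_existence_of_jetK1GeTwoOddWardStrict hE h7

/-- The primary host route's spelling `EnergyNotSigmaSquared.MoebiusLimit` of the tightness equivalence. [cite: DuminilCopinICM2022, §8.4] -/
theorem energyNotSigmaSquared_MoebiusLimit_iff_existence_and_jetK1GeTwoOddWardStrict :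
    EnergyNotSigmaSquared.MoebiusLimit ↔ HyperoctahedralRP.ExistsScaleCovariantLimit ∧ (∀ (ρ : ℝ → ℝ) (Δ : ℝ) (S : CorrFamily 3), (∀ δ ∈ Set.Ioc (0:ℝ) 1, 0 < ρ δ) →
        HasPointwiseScalingLimit (criticalCorr 3) ρ S → (∀ n z, z ∉ NonCoincident 3 n → S n z = 0) →
        IsNondegenerateTwoPoint S → IsEuclideanInvariant S → IsScaleCovariant Δ S →
        1 / 2 < Δ → Δ ≤ 3 / 4 → HasNontrivialU4 S →
        (∀ τ : Fin 3, PointwiseOSReconstruction τ S) →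
        (∀ (n m : ℕ) (x : Fin n → EuclideanSpace ℝ (Fin 3)) (y : Fin m → EuclideanSpace ℝ (Fin 3))
          (v : EuclideanSpace ℝ (Fin 3)), v ≠ 0 →
          Tendsto (fun t : ℝ => S (n + m) (Fin.append x (fun j => y j + t • v)) - S n x * S m y)
            atTop (𝓝 0)) →
        ∀ n, 4 ≤ n → Even n → ∀ k : ℕ, 2 ≤ k → ∀ idx : Fin k → Fin n × Fin 3,
          Odd (Finset.univ.filter fun j => (idx j).2 = 0).card →
          iteratedFDeriv ℝ k (fun x : Fin n → EuclideanSpace ℝ (Fin 3) =>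
            fderiv ℝ (S n) x (fun i => ‖x i‖ ^ 2 • (EuclideanSpace.single 0 1 : EuclideanSpace ℝ (Fin 3)) -
              (2 * inner ℝ (EuclideanSpace.single 0 1 : EuclideanSpace ℝ (Fin 3)) (x i)) • x i) -
            2 * Δ * (∑ i, inner ℝ (EuclideanSpace.single 0 1 : EuclideanSpace ℝ (Fin 3)) (x i)) * S n x)
            (fun i : Fin n => Real.cos (2 * Real.pi * ((i : ℕ) : ℝ) / (n : ℝ)) • (EuclideanSpace.single 1 1 : EuclideanSpace ℝ (Fin 3)) +
              Real.sin (2 * Real.pi * ((i : ℕ) : ℝ) / (n : ℝ)) • (EuclideanSpace.single 2 1 : EuclideanSpace ℝ (Fin 3)))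
            (fun j => Pi.single (idx j).1 (EuclideanSpace.single (idx j).2 (1:ℝ))) = 0) :=
  MoebiusLimitExists_iff_existence_and_jetK1GeTwoOddWardStrict

/-! ## Registered anchor -/

/-- **Registered anchor of this file — the Taylor jet of the `K_{e₀}` Ward defect of an `O(3)`-invariant level at a configuration in
`e₀^⊥` is ODD under the height reflection** (explicit-binder form of `jetK1_heightReflection`). [cite: FrancescoMathieuSenechal1997, §4.1 (4.18)–(4.19)] -/
theorem sctDefectK1_jet_heightReflection_odd : ∀ (n : ℕ) (F : (Fin n → EuclideanSpace ℝ (Fin 3)) → ℝ) (Δ : ℝ), (∀ (R : EuclideanSpace ℝ (Fin 3) ≃ₗᵢ[ℝ] EuclideanSpace ℝ (Fin 3)) (y : Fin n → EuclideanSpace ℝ (Fin 3)), F (fun i => R (y i)) = F y) → ∀ (x₀ : Fin n → EuclideanSpace ℝ (Fin 3)), (∀ i, inner ℝ (EuclideanSpace.single 0 1 : EuclideanSpace ℝ (Fin 3)) (x₀ i) = 0) → ∀ (k : ℕ) (m : Fin k → Fin n → EuclideanSpace ℝ (Fin 3)), iteratedFDeriv ℝ k (fun x : Fin n → EuclideanSpace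 ℝ (Fin 3) => fderiv ℝ F x (fun i => ‖x i‖ ^ 2 • (EuclideanSpace.single 0 1 : EuclideanSpace ℝ (Fin 3)) - (2 * inner ℝ (EuclideanSpace.single 0 1 : EuclideanSpace ℝ (Fin 3)) (x i)) • x i) - 2 * Δ * (∑ i, inner ℝ (EuclideanSpace.single 0 1 : EuclideanSpace ℝ (Fin 3)) (x i)) * F x) x₀ (fun j i => (ℝ ∙ (EuclideanSpace.single 0 1 : EuclideanSpace ℝ (Fin 3)))ᗮ.reflection (m j i)) = -iteratedFDeriv ℝ k (fun x : Fin n → EuclideanSpace ℝ (Fin 3) => fderiv ℝ F x (fun i => ‖x i‖ ^ 2 • (EuclideanSpace.single 0 1 : EuclideanSpace ℝ (Fin 3)) - (2 * inner ℝ (EuclideanSpace.single 0 1 : EuclideanSpace ℝ (Fin 3)) (x i)) • x i) - 2 * Δ * (∑ i, inner ℝ (EuclideanSpace.single 0 1 : EuclideanSpace ℝ (Fin 3)) (x i)) * F x) x₀ m :=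
  fun n F Δ hrot x₀ hplane k m => jetK1_heightReflection n F Δ hrot x₀ hplane k m

end Summit.CriticalPhenomena.Ising3DConformalLimit.MoebiusLimitExistsJetParity

end
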